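import Literature.NumberTheory.ComplexMultiplication.CMTypeRankStabilizerClosure
import Summits.HodgeConjecture.CorCM.IndependentCMFieldsHodge
import HarnessLib

/-!
# Two CM abelian varieties whose type stabilisers generate complex conjugation on one slot ("the reflex fields meet in
# a totally real field"): `Hg(A₀ × A₁) = Hg(A₀) × Hg(A₁)` and the Hodge conjecture on every `A₀^a × A₁^b`

COR-CM (cell `pub-hodgecm2`, binder seat `b16` gen 41, count-neutral claim CM33-PAIRFLIP, file F6; theorems only, no
definition, no named fact).  NEW as stated, hence under `Summits/`.  The CM-field dress of
`Literature/NumberTheory/ComplexMultiplication/CMTypeRankStabilizerClosure`: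

for CM types `Φ_{i₀}`, `Φ_{i₁}` of CM fields `K_{i₀}`, `K_{i₁}` let `S_k = {σ ∈ Aut(ℂ) | σΦ_{i_k} = Φ_{i_k}}` (`= Aut(ℂ/K_k*)`,
`K_k*` the reflex field).  If the subgroup generated by `S₀ ∪ S₁` contains an automorphism acting on `Hom(K_{i₀}, ℂ)`
as complex conjugation — which is the case iff complex conjugation fixes `K₀* ∩ K₁*` pointwise, i.e. the two REFLEX
FIELDS MEET IN A TOTALLY REAL FIELD — then

* **`isNondegenerateFamily_iff_forall_of_conj_mem_closure_stabilizers`** — `(Φ_{i₀}, Φ_{i₁})` is nondegenerate iff both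
  members are (`Hg(A₀ × A₁) = Hg(A₀) × Hg(A₁)`); `cmFamilyRank_add_card_eq_of_conj_mem_closure_stabilizers`;
* **`hodgeConjectureFor_prod_of_conj_mem_closure_stabilizers`** — for nondegenerate members, the Hodge conjecture and
  `B• = D•` on every `⨁_{j<N} A_{π j}`.

This is strictly weaker than the tree's "Galois closures meet in a totally real field"
(`CorCM/RealIntersectionCMFieldsHodge`) since `K* ⊆ L`, and it covers pairs WITH a common constituent: e.g. the two
non-conjugate sextic CM subfields `K⁺(√−m)`, `K⁺(√−md)` (`d = disc K⁺`) of one Galois CM field of degree `12` (for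
primitive types the stabilisers contain `(τ, 1)` and `(τ′, c)` in `Gal = 𝔖₃ × C₂`, generating `c`).  It is the hook for
the remaining cases of the census of pairs of simple CM threefolds (seat card `CM33-PAIRFLIP.md`).

## References

* [Gordon1999HodgeAVSurvey] B. B. Gordon, *A survey of the Hodge conjecture for abelian varieties*, §3 Theorem (proof),
  7.5–7.7, 10.10.
* [Shimura1998] G. Shimura, *Abelian Varieties with Complex Multiplication and Modular Functions*, §8.3.
-/

noncomputable section

open CategoryTheory CategoryTheory.Limits NumberField Module

namespace Summit.HodgeConjecture.CorCM

open Literature.NumberTheory.ComplexMultiplication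
open Literature.AlgebraicGeometry.Motives (AbelianVariety CMType)
open Literature.AlgebraicGeometry.HodgeTheory
open Literature.AlgebraicGeometry.ComplexMultiplication (IsCMTypeRealisation)
open Literature.AlgebraicGeometry.VanGeemen1994 (hodgeClassSpan)
open Literature.AlgebraicGeometry.Pohlmann1968
open Literature.Barriers.HodgeConjecture (divisorClassesSpan)

variable {I : Type} {K : I → Type} [∀ i, Field (K i)] [∀ i, NumberField (K i)] [∀ i, IsCMField (K i)] [Fintype I]
  [DecidableEq I] [Nonempty I] {Φ : ∀ i, CMType (K i)}

omit [∀ i, IsCMField (K i)] [DecidableEq I] [Nonempty I] in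
/-- `|⊔_i Hom(K_i, ℂ)| = Σ_i [K_i : ℚ]`. [folklore] -/
private theorem card_sigma_ringHom_eq_sum' :
    Fintype.card ((i : I) × (K i →+* ℂ)) = ∑ i, Module.finrank ℚ (K i) := by
  rw [Fintype.card_sigma]
  exact Finset.sum_congr rfl fun i _ => Embeddings.card (K i) ℂ

/-! ## §1 Types -/

section Types

/-- **Type stabilisers generating complex conjugation on one slot ⟹ the pair is nondegenerate iff its members are**
(`Hg(A₀ × A₁) = Hg(A₀) × Hg(A₁)`; the reflex fields meet in a totally real field).
[cite: Gordon1999HodgeAVSurvey, §3 Theorem and 7.5–7.7] [cite: Shimura1998, §8.3] -/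
theorem isNondegenerateFamily_iff_forall_of_conj_mem_closure_stabilizers {i₀ i₁ : I} (h01 : i₀ ≠ i₁)
    (hI : ∀ j, j = i₀ ∨ j = i₁)
    (hg : ∃ g ∈ Subgroup.closure
        ({s : ℂ ≃+* ℂ | ∀ x : K i₀ →+* ℂ, s • x ∈ (Φ i₀).1 ↔ x ∈ (Φ i₀).1} ∪
          {s : ℂ ≃+* ℂ | ∀ y : K i₁ →+* ℂ, s • y ∈ (Φ i₁).1 ↔ y ∈ (Φ i₁).1}),
      ∀ x : K i₀ →+* ℂ, g • x = (starRingAut : ℂ ≃+* ℂ) • x) :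
    CMAlgebra.IsNondegenerateFamily Φ ↔ ∀ i, IsNondegenerate (Φ i) := by
  classical
  have key := typeRank_sigmaType_eq_iff_forall_of_smul_eq_rho_of_mem_closure (G := ℂ ≃+* ℂ)
    (Φ := fun i => (Φ i).1) (fun i => isCMTypeWith_conj (Φ i)) hI h01 hg
  rw [CMAlgebra.isNondegenerateFamily_iff, cmFamilyRank_eq_typeRank_sigmaType, ← card_sigma_ringHom_eq_sum' (K := K)]
  refine key.trans (forall_congr' fun i => ?_)
  rw [isNondegenerate_iff, cmTypeRank, ← Embeddings.card (K i) ℂ]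

/-- **Rank additivity**: `rank(Φ₀, Φ₁) + 2 = rank Φ₀ + rank Φ₁ + 1` under the same hypothesis.
[cite: Gordon1999HodgeAVSurvey, §3 Theorem (1)] -/
theorem cmFamilyRank_add_card_eq_of_conj_mem_closure_stabilizers {i₀ i₁ : I} (h01 : i₀ ≠ i₁)
    (hI : ∀ j, j = i₀ ∨ j = i₁)
    (hg : ∃ g ∈ Subgroup.closure
        ({s : ℂ ≃+* ℂ | ∀ x : K i₀ →+* ℂ, s • x ∈ (Φ i₀).1 ↔ x ∈ (Φ i₀).1} ∪
          {s : ℂ ≃+* ℂ | ∀ y : K i₁ →+* ℂ, s • y ∈ (Φ i₁).1 ↔ y ∈ (Φ i₁).1}),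
      ∀ x : K i₀ →+* ℂ, g • x = (starRingAut : ℂ ≃+* ℂ) • x) :
    CMAlgebra.cmFamilyRank Φ + Fintype.card I = (∑ i, cmTypeRank (Φ i)) + 1 := by
  classical
  exact typeRank_sigmaType_add_card_eq_of_smul_eq_rho_of_mem_closure (G := ℂ ≃+* ℂ)
    (Φ := fun i => (Φ i).1) (fun i => isCMTypeWith_conj (Φ i)) hI h01 hg

end Types

/-! ## §2 Abelian varieties -/

section Geometry

variable {A : I → AbelianVariety ℂ} {ι : ∀ i, 𝓞 (K i) →+* End (A i)}
  {θ : ∀ i, K i →+* Module.End ℂ (complexBetti (A i).X 1)}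

/-- **The Hodge conjecture on every `A₀^a × A₁^b`** (every `⨁_{j<N} A_{π j}`), with `B• = D•` there, for realisations
of NONDEGENERATE types whose stabilisers generate complex conjugation on one slot — UNCONDITIONAL.
[cite: Gordon1999HodgeAVSurvey, §3 Theorem and 10.10] -/
theorem hodgeConjectureFor_prod_of_conj_mem_closure_stabilizers {i₀ i₁ : I} (h01 : i₀ ≠ i₁)
    (hI : ∀ j, j = i₀ ∨ j = i₁)
    (hg : ∃ g ∈ Subgroup.closure
        ({s : ℂ ≃+* ℂ | ∀ x : K i₀ →+* ℂ, s • x ∈ (Φ i₀).1 ↔ x ∈ (Φ i₀).1} ∪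
          {s : ℂ ≃+* ℂ | ∀ y : K i₁ →+* ℂ, s • y ∈ (Φ i₁).1 ↔ y ∈ (Φ i₁).1}),
      ∀ x : K i₀ →+* ℂ, g • x = (starRingAut : ℂ ≃+* ℂ) • x)
    (hnd : ∀ i, IsNondegenerate (Φ i)) (hA : ∀ i, IsCMTypeRealisation (Φ i) (A i) (ι i) (θ i)) {N : ℕ}
    (π : Fin N → I) :
    HodgeConjectureFor (⨁ fun j : Fin N => A (π j)).dim (⨁ fun j : Fin N => A (π j)).X ∧
      ∀ m : ℕ, hodgeClassSpan (⨁ fun j : Fin N => A (π j)).dim (⨁ fun j : Fin N => A (π j)).X m =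
        divisorClassesSpan (⨁ fun j : Fin N => A (π j)).X (⨁ fun j : Fin N => A (π j)).dim m :=
  have h := (isNondegenerateFamily_iff_forall_of_conj_mem_closure_stabilizers h01 hI hg).2 hnd
  ⟨h.hodgeConjectureFor_prod hA π, fun m => h.hodgeClassSpan_prod_eq_divisorClassesSpan hA π m⟩

/-- **No exceptional Hodge class on any `A₀^a × A₁^b`** under the same hypotheses.
[cite: Gordon1999HodgeAVSurvey, 7.5 and 7.6.1] -/
theorem not_exists_exceptional_prod_of_conj_mem_closure_stabilizers {i₀ i₁ : I} (h01 : i₀ ≠ i₁)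
    (hI : ∀ j, j = i₀ ∨ j = i₁)
    (hg : ∃ g ∈ Subgroup.closure
        ({s : ℂ ≃+* ℂ | ∀ x : K i₀ →+* ℂ, s • x ∈ (Φ i₀).1 ↔ x ∈ (Φ i₀).1} ∪
          {s : ℂ ≃+* ℂ | ∀ y : K i₁ →+* ℂ, s • y ∈ (Φ i₁).1 ↔ y ∈ (Φ i₁).1}),
      ∀ x : K i₀ →+* ℂ, g • x = (starRingAut : ℂ ≃+* ℂ) • x)
    (hnd : ∀ i, IsNondegenerate (Φ i)) (hA : ∀ i, IsCMTypeRealisation (Φ i) (A i) (ι i) (θ i)) {N : ℕ}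
    (π : Fin N → I) (m : ℕ) :
    ¬∃ c : complexBetti (⨁ fun j : Fin N => A (π j)).X (2 * m), IsRationalClass c ∧
        IsOfHodgeType (⨁ fun j : Fin N => A (π j)).dim (⨁ fun j : Fin N => A (π j)).X (2 * m) m m c ∧
        c ∉ divisorClassesSpan (⨁ fun j : Fin N => A (π j)).X (⨁ fun j : Fin N => A (π j)).dim m :=
  ((isNondegenerateFamily_iff_forall_of_conj_mem_closure_stabilizers h01 hI hg).2 hnd).not_exists_exceptional_prod
    hA π m

end Geometry

end Summit.HodgeConjecture.CorCM

end
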